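/- Copyright: the b2b-balaban cell (near-miss cell 7), T⁴-continuum fan-out, row-NE7b OWNER lineage `t4-ne7b-p1` (gen 101) —
(α)-instance, THE END AT THE TOWER, part 2: the road.  Released under the licence of the surrounding project. -/
import Summits.QuantumFields.BalabanUV.T4Continuum.Support.B16HistoryTowerEndDataLWL
import Summits.QuantumFields.BalabanUV.T4Continuum.Support.HistoryRealiseCellsRunAssemblyWTVSLWLP82

/-!
# (α)-INSTANCE — THE END AT THE TOWER, part 2: `TowerReadDataLWL.toLWL` AND THE TERMINAL THEOREM
`continuumYM4Torus_of_towerReadingLWL_fsc`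

Summits-side support leaf of the T⁴-continuum cell (rung (B)+1 on a FINITE torus only; NOT infinite volume, NOT the mass gap, NOT
Clay; NOT a proof of NE7b — the cell's OWN estimate `T4WeightBudget.RelWeightBound`, NOT PRINTED, NOT PROVED).  [folklore]
composition BY NAME: one `def` (the embedding `TowerReadDataLWL.toLWL` into the END record of record `HistReadDataLWL`, p303444) and
one terminal theorem (= `HistoryRealiseCellsRunAssemblyWTVSLWLP82.continuumYM4Torus_of_histReadingLWL_fsc`, p303949, ∘ `toLWL` inside
`ForSmallCouplings`); no `Prop` minted, nothing cited as hypothesis, zero `sorry`.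

WHAT `toLWL` DISCHARGES (the nine run-A slots of `HistReadDataLWL`, each by a named J-chain theorem; everything else is copied):
`RA := reprFam T p₀ ρ₀ …` ∕ `ρA := densFam T ρ₀` (IR-97-2), **`holdsA := holdsFam`** ((1.72) holds — a theorem of the tower),
`ℛ := 𝒮.reading T p₀` (IR-99-3), `Φf := factorsPinned …` (IR-100-1 (A) v2), **`hR := histRead_of_hwPinned … hw hBρ hν0`** (THE
identification R2 — from the ONE per-step display `hw`), **`hN := newOK_run … hν`**, `hRm`∕`hRmS`∕`hRm2` from the flow rows (the
reading's runs carry `𝒮.Rm K`, `𝒮.R K` by `rfl`), **`hF := factorRead_factorsPinned`** (`rfl`: the values ARE the suppression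
exponentials of the letters), **`hΛL := log_Λ_factorsPinned`** (`Real.log_exp`: the pinned volume letter IS `exp ∘ uvolL`), `hBA` at
`BA K t = log (B K t)` (`rfl`).

THE TERMINAL THEOREM: `T4ContinuumYM4Torus.ContinuumYM4Torus D` for (0.4)-block-averaged data on `SU(N)` with a measurable small-loop
average, GIVEN `(B)` and `BetaPertHyp` BY NAME, the sign conventions, the constants-only side conditions of the `_fsc` family, the
eleven window-threshold letters, and — for all small-coupling tuned runs and every loop string — SOME tower-form record
`TowerReadDataLWL …` (choice type, level classes, measures, run B's carriers existentially).  A NEW statement only because the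
record TYPE is new; CONDITIONAL on everything the record displays.  BY-NAME EFFECT ON `WALL-NE7b-P1.md` §2: the terminal theorem of
record no longer carries R2 (`HistRead`), `holdsA`, `hN`, `hF`, `hΛL` as free displays — for a tower-form run they are THEOREMS; what it
carries instead is `hw : HwPinned T 𝒮 …` over an ABSTRACT tower (R-class until (A1c) names Bałaban's tower and J4 reads `hw` off
`B16StepFactorsPrinted`).  NE7b NOT proved; count 0∕9.  HONEST DEPENDENCY (cell): continuum YM on T⁴ ⇐ BetaPertH ∧ nine spine
estimates (0/9 proved); BetaPertH ⇐ (D1) ∧ (D4) ∧ CAP+tail; G-an2-4 gates asym, D1 and NE2/3/4.  This file changes none of it.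
-/

open Finset MeasureTheory
open Literature.MathematicalPhysics.QuantumFieldTheory.Balaban1983to89
open T4PersistenceDictionary T4PersistentHistoryCount T4BankedInduction T4PrintedShapeBanking
open T4WeightBudget T4GlobalDenominator T4LiveClassFibration T4LiveStructureGas T4LiveGasToTerms T4RecordPriceSeam
open T4PartnerMultiplicity T4IndicatorShell T4MatchingAssembly T4MatchingClosure T4MatchingClosureSocket T4Continuum
open T4StabilitySocket T4BranchingRecordsGas T4TaggedShapeBanking T4CanonicalMenus T4RenewalChains
open Summit.QuantumFields.BalabanUV.T4Continuum.PlacementBatch Summit.QuantumFields.BalabanUV.T4Continuum.PlacementSkeleton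
open Summit.QuantumFields.BalabanUV.T4Continuum.CountThresholdUniform Summit.QuantumFields.BalabanUV.T4Continuum.CountThresholdExit
open Summit.QuantumFields.BalabanUV.T4Continuum.CountSeamJunction Summit.QuantumFields.BalabanUV.T4Continuum.LateMergers
open Summit.QuantumFields.BalabanUV.T4Continuum.HistoryFlow Summit.QuantumFields.BalabanUV.T4Continuum.HistoryRegeneration
open Summit.QuantumFields.BalabanUV.T4Continuum.HistoryTables Summit.QuantumFields.BalabanUV.T4Continuum.HistoryAssemblyTrees
open Summit.QuantumFields.BalabanUV.T4Continuum.HistoryAssemblyTerms Summit.QuantumFields.BalabanUV.T4Continuum.HistoryAssemblyPedigree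
open Summit.QuantumFields.BalabanUV.T4Continuum.HistoryConstants Summit.QuantumFields.BalabanUV.T4Continuum.HistoryGen
open Literature.MathematicalPhysics.QuantumFieldTheory.Balaban1983to89.B13ScaleTransfer
open Summit.QuantumFields.BalabanUV.T4Continuum.ZoneSkeleton Summit.QuantumFields.BalabanUV.T4Continuum.HistorySocketTH
open Summit.QuantumFields.BalabanUV.T4Continuum.HistoryCaps Summit.QuantumFields.BalabanUV.T4Continuum.HistoryAssemblyPrice
open Summit.QuantumFields.BalabanUV.T4Continuum.HistoryBankingLE Summit.QuantumFields.BalabanUV.T4Continuum.HistoryExitLE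
open Summit.QuantumFields.BalabanUV.T4Continuum.HistoryAssemblyTreesLE Summit.QuantumFields.BalabanUV.T4Continuum.HistoryAssemblyTermsLE
open Summit.QuantumFields.BalabanUV.T4Continuum.HistoryRealise Summit.QuantumFields.BalabanUV.T4Continuum.HistoryAssemblyRealiseLE
open Summit.QuantumFields.BalabanUV.T4Continuum.HistoryAssemblyMult Summit.QuantumFields.BalabanUV.T4Continuum.HistoryAssemblyMultKey
open Summit.QuantumFields.BalabanUV.T4Continuum.HistoryAssemblyRealiseRun Summit.QuantumFields.BalabanUV.T4Continuum.HistoryAssemblyRealiseMult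
open Summit.QuantumFields.BalabanUV.T4Continuum.HistoryZones Summit.QuantumFields.BalabanUV.T4Continuum.HistoryRealiseCells
open Summit.QuantumFields.BalabanUV.T4Continuum.HistoryRealiseCellsRun Summit.QuantumFields.BalabanUV.T4Continuum.HistoryAssemblyRealiseRunMult
open Summit.QuantumFields.BalabanUV.T4Continuum.HistoryRealiseCellsRunMult Summit.QuantumFields.BalabanUV.T4Continuum.HistoryAssemblyMultInstance
open Summit.QuantumFields.BalabanUV.T4Continuum.HistoryJoinsPlacedMember Summit.QuantumFields.BalabanUV.T4Continuum.PlacementSkeleton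
open Summit.QuantumFields.BalabanUV.T4Continuum.HistoryJoinsPlacedMult Summit.QuantumFields.BalabanUV.T4Continuum.HistoryRealiseDistinct
open Summit.QuantumFields.BalabanUV.T4Continuum.HistoryRegionTemplates Summit.QuantumFields.BalabanUV.T4Continuum.HistoryCaps
open Summit.QuantumFields.BalabanUV.T4Continuum.HistoryZoneEvolve (cth)
open Literature.MathematicalPhysics.QuantumFieldTheory.Balaban1983to89.B16SProfile (DropCtl)
open Summit.QuantumFields.BalabanUV.T4Continuum.HistoryRealiseCellsRunMultEnd Summit.QuantumFields.BalabanUV.T4Continuum.HistoryRealiseCellsRunMultEndD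
open Summit.QuantumFields.BalabanUV.T4Continuum.HistoryRealiseCellsRunPinnedT3b Summit.QuantumFields.BalabanUV.T4Continuum.HistoryHybridRescale
open Summit.QuantumFields.BalabanUV.T4Continuum.HistoryRealiseCellsRunApex (exists_const_schemeZ)
open Summit.QuantumFields.BalabanUV.T4Continuum.HistoryRealisePrint Summit.QuantumFields.BalabanUV.T4Continuum.HistoryRealiseWeak
open Summit.QuantumFields.BalabanUV.T4Continuum.HistoryRealisePrintReading Summit.QuantumFields.BalabanUV.T4Continuum.HistoryRealiseWeakReading
open Summit.QuantumFields.BalabanUV.T4Continuum.HistoryRealisePrintCells Summit.QuantumFields.BalabanUV.T4Continuum.HistoryRealiseWeakCells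
open Summit.QuantumFields.BalabanUV.T4Continuum.HistoryRealiseCellsRunApexT3b Summit.QuantumFields.BalabanUV.T4Continuum.HistoryRealiseCellsRunApexT3bW

open Summit.QuantumFields.BalabanUV.T4Continuum.HistoryRealiseCellsRunApexT3bWT Summit.QuantumFields.BalabanUV.T4Continuum.HistoryRealiseCellsRunPinnedT3bWT
open Summit.QuantumFields.BalabanUV.T4Continuum.HistoryRealiseCellsRunHeadlineT3bWT
open Summit.QuantumFields.BalabanUV.T4Continuum.HistoryRealiseCellsRunApexT3bWTV Summit.QuantumFields.BalabanUV.T4Continuum.HistoryBankingVolumePlug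
open Summit.QuantumFields.BalabanUV.T4Continuum.HistoryRealiseCellsRunApexT3bWTVS
open Summit.QuantumFields.BalabanUV.T4Continuum.HistoryGenealogyRealise
open Summit.QuantumFields.BalabanUV.T4Continuum.HistoryGenealogyInstantiate
open Summit.QuantumFields.BalabanUV.T4Continuum.B16HistoryIndexedRepr
open Summit.QuantumFields.BalabanUV.T4Continuum.B16HistoryIndexedTrunc
open Summit.QuantumFields.BalabanUV.T4Continuum.HistoryBankingDiscountCharge
open Summit.QuantumFields.BalabanUV.T4Continuum.HistoryBankingCreditRead
open Summit.QuantumFields.BalabanUV.T4Continuum.HistoryBankingFibreRoom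
open Summit.QuantumFields.BalabanUV.T4Continuum.HistoryPriceKeys
open Summit.QuantumFields.BalabanUV.T4Continuum.HistoryRealiseCellsRunSupplyWTVS
open Summit.QuantumFields.BalabanUV.T4Continuum.HistoryRealiseCellsRunSupplyKeysWTVS

open Summit.QuantumFields.BalabanUV.T4Continuum.HistoryRealiseCellsRunAssemblyWTVSData
open Summit.QuantumFields.BalabanUV.T4Continuum.HistoryRealiseCellsRunAssemblyWTVSDataL
open Summit.QuantumFields.BalabanUV.T4Continuum.HistoryRealiseCellsRunAssemblyWTVSDataLW
open Summit.QuantumFields.BalabanUV.T4Continuum.HistoryRealiseCellsRunAssemblyWTVSL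
open Summit.QuantumFields.BalabanUV.T4Continuum.HistoryRealiseCellsRunApexT3bWTVSL
open Summit.QuantumFields.BalabanUV.T4Continuum.HistoryBankingSharpShares (sBsharp)
open Summit.QuantumFields.BalabanUV.T4Continuum.HistoryBankingRoundingSupply (ellStar)
open Summit.QuantumFields.BalabanUV.T4Continuum.HistoryBankingRoundingUnrounded (sRunr ApFlat)
open Summit.QuantumFields.BalabanUV.T4Continuum.HistoryBankingRoundingTuned
open Summit.QuantumFields.BalabanUV.T4Continuum.HistoryBankingVolumeWindow
open Summit.QuantumFields.BalabanUV.T4Continuum.HistoryBankingVolumeSupply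

open Summit.QuantumFields.BalabanUV.T4Continuum.HistoryBankingForestVolume
open Summit.QuantumFields.BalabanUV.T4Continuum.HistoryBankingForestPlug
open Summit.QuantumFields.BalabanUV.T4Continuum.HistoryBankingAnchors82
open Summit.QuantumFields.BalabanUV.T4Continuum.HistoryBankingShrunkLedger82
open Summit.QuantumFields.BalabanUV.T4Continuum.HistoryBankingShrunkWitness82
open Summit.QuantumFields.BalabanUV.T4Continuum.HistoryBankingVolumeWindowCollar
open Summit.QuantumFields.BalabanUV.T4Continuum.HistoryBankingVolumeWindowShrunk82
open Summit.QuantumFields.BalabanUV.T4Continuum.B16HistoryWeightPlugW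
open Summit.QuantumFields.BalabanUV.T4Continuum.HistoryRealiseCellsRunSupplyWTVSW
open Summit.QuantumFields.BalabanUV.T4Continuum.HistoryRealiseCellsRunAssemblyWTVSDataLW
open Summit.QuantumFields.BalabanUV.T4Continuum.HistoryRealiseCellsRunAssemblyWTVSDataLP
open Summit.QuantumFields.BalabanUV.T4Continuum.HistoryRealiseCellsRunAssemblyWTVSLW
open Summit.QuantumFields.BalabanUV.T4Continuum.HistoryRealiseCellsRunAssemblyWTVSLP
open Summit.QuantumFields.BalabanUV.T4Continuum.HistoryBankingVolumeWindowLattice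
open Summit.QuantumFields.BalabanUV.T4Continuum.HistoryRealiseCellsRunAssemblyWTVSLWP82
open Summit.QuantumFields.BalabanUV.T4Continuum.HistoryRealiseCellsRunAssemblyWTVSDataLWL
open Literature.MathematicalPhysics.QuantumFieldTheory.Balaban1983to89.TreeLength
open Literature.MathematicalPhysics.QuantumFieldTheory.Balaban1983to89.B16MergeGeometry
open Summit.QuantumFields.BalabanUV.T4Continuum.HistoryAdmissible
open Summit.QuantumFields.BalabanUV.T4Continuum.HistoryGenealogyExtraction
open Summit.QuantumFields.BalabanUV.T4Continuum.HistoryGenealogyPedigree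
open Summit.QuantumFields.BalabanUV.T4Continuum.HistoryTouchComponents
open Summit.QuantumFields.BalabanUV.T4Continuum.HistoryBankingSharpShares (ell)
open Summit.QuantumFields.BalabanUV.T4Continuum.B16HistoryReprChain
open Summit.QuantumFields.BalabanUV.T4Continuum.B16HistoryReprInstance
open Summit.QuantumFields.BalabanUV.T4Continuum.B16HistoryReprRead
open Summit.QuantumFields.BalabanUV.T4Continuum.B16HistoryReprReadCausal
open Summit.QuantumFields.BalabanUV.T4Continuum.B16HistoryStepDisplayPinned
open Summit.QuantumFields.BalabanUV.T4Continuum.HistoryRealiseCellsRunAssemblyWTVSLWLP82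
open Summit.QuantumFields.BalabanUV.T4Continuum.B16HistoryTowerEndDataLWL

namespace Summit.QuantumFields.BalabanUV.T4Continuum.B16HistoryTowerEndLWLP82

noncomputable section

set_option synthInstance.maxSize 1024

/-! ## §1 The embedding: the lattice-unit prefix record of record FROM a tower-form record -/

section Embed

variable {F : T4Family} {G : Type*} [GaugeGroup G] [MeasurableSpace G] [HaarData G] [RegularGaugeGroup G]
  {D : FiniteEpsData F G} {C : T4PrintedShapeBanking.Consts} {O : PrintedO1s} {θv : ℝ} {rr d n : ℕ} {hn : 0 < n}
  {g₀ : ℕ → ℝ} {os : List (ULoop F)} {cΛ M Lr Φ β₀ : ℝ} {p₁ η η' κ κ₂ κᵥ : ℕ}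
  {P : Type} [DecidableEq P] {X : ℕ → ℕ → Type} {𝒢 : (K j : ℕ) → GoodClass (X K j)}
  [∀ K, MeasurableSpace (X K K)] {μ : (K : ℕ) → Measure (X K K)} [∀ K, IsFiniteMeasure (μ K)]
  {DomK' : ℕ → Type} {I' : (K : ℕ) → HIndex (DomK' K)}
  {Y : ℕ → Type} [∀ K, MeasurableSpace (Y K)] {νB : (K : ℕ) → Measure (Y K)} [∀ K, IsFiniteMeasure (νB K)]
  {𝒢' : (K : ℕ) → GoodClass (Y K)}

omit [RegularGaugeGroup G] in
/-- **THE END RECORD OF RECORD FROM A TOWER-FORM RECORD**: `HistReadDataLWL` at `I := skelFam T p₀`, `X K := X K K`, `𝒢 K := 𝒢 K K`,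
with the nine run-A slots DISCHARGED by the J-chain — `RA := reprFam`, `ρA := densFam`, `holdsA := holdsFam hp₀`, `ℛ := 𝒮.reading
T p₀`, `Φf := factorsPinned … hcΛ hMΛ hℓ`, `hR := histRead_of_hwPinned … hw hBρ hν0`, `hN := newOK_run … hν`, `hRm`∕`hRmS`∕`hRm2` from
the flow rows, `hF := factorRead_factorsPinned`, `hΛL := log_Λ_factorsPinned`, `hBA` at `BA = log ∘ B` — and every other field
copied. [folklore] -/
def _root_.Summit.QuantumFields.BalabanUV.T4Continuum.B16HistoryTowerEndDataLWL.TowerReadDataLWL.toLWL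
    (Dd : TowerReadDataLWL D C O θv rr d n hn g₀ os cΛ M Lr Φ β₀ p₁ η η' κ κ₂ κᵥ P X 𝒢 μ I' Y νB 𝒢') :
    HistReadDataLWL D C O θv rr d n hn g₀ os cΛ M Lr Φ β₀ p₁ η η' κ κ₂ κᵥ (skelFam Dd.T Dd.p₀) I' (fun K => X K K) μ
      (fun K => 𝒢 K K) Y νB 𝒢' where
  l₀ := Dd.l₀
  vol := Dd.vol
  l₀_pos := Dd.l₀_pos
  vol_pos := Dd.vol_pos
  K₀ := Dd.K₀
  RA := reprFam Dd.T Dd.p₀ Dd.ρ₀ Dd.hρ₀ Dd.h0 Dd.B Dd.hB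
  ρA := densFam Dd.T Dd.ρ₀
  holdsA := holdsFam Dd.T Dd.p₀ Dd.ρ₀ Dd.hρ₀ Dd.h0 Dd.B Dd.hB Dd.hp₀
  intA := Dd.intA
  H2A := Dd.H2A
  ℛ := Dd.𝒮.reading Dd.T Dd.p₀
  hL := Dd.hL
  hs := Dd.hs
  Φf := factorsPinned Dd.T Dd.p₀ Dd.𝒮 Dd.B Dd.sB (sRpin D O Lr p₁ g₀ Dd.𝒮.R) cΛ M (gsOf D g₀) Dd.hcΛ Dd.hMΛ Dd.hℓ
  hR := histRead_of_hwPinned Dd.T Dd.p₀ Dd.𝒮 Dd.ρ₀ Dd.hρ₀ Dd.h0 Dd.B Dd.hB Dd.sB (sRpin D O Lr p₁ g₀ Dd.𝒮.R) cΛ M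
    (gsOf D g₀) Dd.hcΛ Dd.hMΛ Dd.hℓ Dd.hw Dd.hBρ Dd.hν0
  isRj := Dd.isRj
  one_le_R := Dd.one_le_R
  hL4 := Dd.hL4
  hprof := Dd.hprof
  hdrop := Dd.hdrop
  hN := fun K _ τ _ => Dd.𝒮.newOK_run Dd.T Dd.p₀ Dd.hν K τ
  hRm := fun K _ _ _ t k => Dd.hRm K t k
  hRmS := fun K hK _ _ t k => Dd.hRmS K hK t k
  hRm2 := fun K hK _ _ t => Dd.hRm2 K hK t
  hD := Dd.hD
  hreg := Dd.hreg
  hn₁ := Dd.hn₁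
  hE₂ := Dd.hE₂
  hE₃pos := Dd.hE₃pos
  sB := Dd.sB
  φB := Dd.φB
  φR := Dd.φR
  β' := Dd.β'
  hF := fun K _ =>
    factorRead_factorsPinned Dd.T Dd.p₀ Dd.𝒮 Dd.B Dd.sB (sRpin D O Lr p₁ g₀ Dd.𝒮.R) cΛ M (gsOf D g₀) Dd.hcΛ Dd.hMΛ Dd.hℓ K
  h29 := Dd.h29
  W := Dd.W
  one_le_W := Dd.one_le_W
  Wi := Dd.Wi
  BAi := Dd.BAi
  mi := Dd.mi
  hWi := Dd.hWi
  hBA := Dd.hBA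
  hmi := Dd.hmi
  hρ := Dd.hρ
  c₀ := Dd.c₀
  n₁ := Dd.n₁
  c₀_pos := Dd.c₀_pos
  floor := Dd.floor
  floor' := Dd.floor'
  sites := Dd.sites
  sites' := Dd.sites'
  RB := Dd.RB
  ρB := Dd.ρB
  holdsB := Dd.holdsB
  intB := Dd.intB
  H2B := Dd.H2B
  trunc := Dd.trunc
  htr := Dd.htr
  dB := Dd.dB
  mup := Dd.mup
  sB' := Dd.sB'
  φB' := Dd.φB'
  φR' := Dd.φR'
  upB := Dd.upB
  deadB_nonneg := Dd.deadB_nonneg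
  resumB := Dd.resumB
  mup_bd := Dd.mup_bd
  shA := Dd.shA
  shB := Dd.shB
  Wsh := Dd.Wsh
  shell := Dd.shell
  Cc := Dd.Cc
  Rr := Dd.Rr
  CcRec := Dd.CcRec
  RrRec := Dd.RrRec
  ν := Dd.ν
  u := Dd.u
  s₂ := Dd.s₂
  q₀ := Dd.q₀
  r := Dd.r
  s := Dd.s
  budget := Dd.budget
  sum_r := Dd.sum_r
  sum_u := Dd.sum_u
  sum_s := Dd.sum_s
  sum_s₂ := Dd.sum_s₂
  hcΛ := Dd.hcΛ
  hMΛ := Dd.hMΛ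
  hΛL := log_Λ_factorsPinned Dd.T Dd.p₀ Dd.𝒮 Dd.B Dd.sB (sRpin D O Lr p₁ g₀ Dd.𝒮.R) cΛ M (gsOf D g₀) Dd.hcΛ Dd.hMΛ Dd.hℓ
  hθv := Dd.hθv
  hβ₀ := Dd.hβ₀
  hLr := Dd.hLr
  hΦ := Dd.hΦ
  m := Dd.m
  hm := Dd.hm
  hexpR := Dd.hexpR
  hexpR' := Dd.hexpR'
  hexpB := Dd.hexpB
  hexpFL := Dd.hexpFL
  hdq := Dd.hdq
  hexpVL := Dd.hexpVL
  hη := Dd.hη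
  hη' := Dd.hη'
  hκ := Dd.hκ
  hκ₂ := Dd.hκ₂
  hκᵥ := Dd.hκᵥ
  hp₀ := Dd.hp₀c
  hAp := Dd.hAp
  hγ₀ := Dd.hγ₀
  hA₁ := Dd.hA₁
  hA₀ := Dd.hA₀
  hM := Dd.hM
  hβd := Dd.hβd
  hφB := Dd.hφB
  hφR := Dd.hφR
  hφB' := Dd.hφB'
  hφR' := Dd.hφR'
  hsB := Dd.hsB
  hsB' := Dd.hsB'
  p27 := Dd.p27
  hp27 := Dd.hp27
  h27 := Dd.h27

omit [RegularGaugeGroup G] in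
/-- the embedding's reading, bundle, operations, threshold and source radius are the tower's (by `rfl`) [folklore] -/
theorem _root_.Summit.QuantumFields.BalabanUV.T4Continuum.B16HistoryTowerEndDataLWL.TowerReadDataLWL.toLWL_data
    (Dd : TowerReadDataLWL D C O θv rr d n hn g₀ os cΛ M Lr Φ β₀ p₁ η η' κ κ₂ κᵥ P X 𝒢 μ I' Y νB 𝒢') :
    Dd.toLWL.ℛ = Dd.𝒮.reading Dd.T Dd.p₀ ∧
      Dd.toLWL.Φf = factorsPinned Dd.T Dd.p₀ Dd.𝒮 Dd.B Dd.sB (sRpin D O Lr p₁ g₀ Dd.𝒮.R) cΛ M (gsOf D g₀) Dd.hcΛ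
        Dd.hMΛ Dd.hℓ ∧
      Dd.toLWL.RA = reprFam Dd.T Dd.p₀ Dd.ρ₀ Dd.hρ₀ Dd.h0 Dd.B Dd.hB ∧ Dd.toLWL.K₀ = Dd.K₀ ∧ Dd.toLWL.l₀ = Dd.l₀ :=
  ⟨rfl, rfl, rfl, rfl, rfl⟩

end Embed

/-! ## §1b One more display discharged IN THE MODEL CLASS: `intA` for a tower relative to `bddMeas` -/

section Model

variable {P : Type} [DecidableEq P] {X : ℕ → ℕ → Type} [∀ K j, MeasurableSpace (X K j)]

/-- **THE RECORD's `intA` IS A THEOREM FOR A TOWER IN THE MODEL CLASS**: if every level's good class is `bddMeas` (bounded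
measurable functions — IR-97-2 part 1's model), every elementary term of the tower's operations `reprFam` is integrable under any
finite measure on the last level (`B16HistoryReprChain.intA_of_bddMeas`, by name).  So a tower-form record relative to `bddMeas`
fills its `intA` slot with this theorem; the slot stays displayed in `TowerReadDataLWL` only because the record is stated for an
arbitrary good class. [folklore] -/
theorem intA_reprFam_bddMeas (T : (K : ℕ) → Tower P (X K) (fun j => bddMeas (X K j))) (p₀ : ℕ → ℕ → P)
    (ρ₀ : (K : ℕ) → ℝ → X K 0 → ℝ) (hρ₀ : ∀ K t, (bddMeas (X K 0)).Gd (ρ₀ K t)) (h0 : ∀ K t x, 0 ≤ ρ₀ K t x)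
    (B : ℕ → ℝ → ℝ) (hB : ∀ K t, 0 < B K t) (μ : (K : ℕ) → Measure (X K K)) [∀ K, IsFiniteMeasure (μ K)]
    (K : ℕ) (t : ℝ) (a : (skelFam T p₀ K).Adm) (ι : (skelFam T p₀ K).HZ × (skelFam T p₀ K).HL × (skelFam T p₀ K).HC) :
    Integrable ((reprFam T p₀ ρ₀ hρ₀ h0 B hB K t).eterm a ι) (μ K) :=
  intA_of_bddMeas (μ K) (reprFam T p₀ ρ₀ hρ₀ h0 B hB K t) a ι

end Model

/-! ## §2 The terminal theorem: the headline from SOME tower-form record, for all small couplings -/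

section SU

variable {F : T4Family} {N : ℕ} [NeZero N] {ℰ : LoopAverage (Matrix.specialUnitaryGroup (Fin N) ℂ)}

/-- **THE HEADLINE PREDICATE FROM A TOWER-FORM READING OF (1.72) UNDER THE HEADLINE's OWN PREFIX, VOLUME LETTER IN LATTICE UNITS**:
`T4ContinuumYM4Torus.ContinuumYM4Torus D` for (0.4)-block-averaged data on `SU(N)` with a measurable small-loop average, GIVEN `(B)` and
`BetaPertHyp` BY NAME, the sign conventions, the `_fsc` family's constants-only side conditions, the eleven window-threshold letters
`cΛ M Lr Φ b₀ p₁ η η′ κ κ₂ κᵥ`, and — for all small-coupling tuned runs and every loop string — SOME tower-form record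
`TowerReadDataLWL …` (choice type, level classes, measures, run B's carriers existentially).  Proof:
`continuumYM4Torus_of_histReadingLWL_fsc` ∘ `ForSmallCouplings.mono` ∘ §1 `toLWL`.  CONDITIONAL on everything the record displays —
in particular on the per-step display `hw : HwPinned T 𝒮 …` over an ABSTRACT tower; NE7b NOT proved; count 0∕9. [folklore] -/
theorem continuumYM4Torus_of_towerReadingLWL_fsc (D : FiniteEpsData F (Matrix.specialUnitaryGroup (Fin N) ℂ))
    (hBA : D.IsBlockAveraged ℰ) (hE : ℰ.MeasurableE)
    (hB : B16.EndStatementBPrinted D.C) (hβ : BetaPertHyp D.βfun) (hsign : B16.SignConventions D.C)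
    {C : T4PrintedShapeBanking.Consts} {O : PrintedO1s}
    {rr : ℕ} {β₀ : ℝ} (h : ThresholdOK C F.L rr β₀) (hμ : 0 < C.μ) (d n : ℕ)
    (hκ₁ : (d : ℝ) * Real.log F.L + 2 * Real.log 2 ≤ C.κ₁) (hE₀ : Real.log (2 + birthMass C) ≤ C.E₀)
    (hA₀ : 1 ≤ C.A₀) (hβ₀ : 0 < β₀) (hLβ : (F.L : ℝ) * β₀ ≤ 1) (hn₁ : 13 ≤ C.n₁) (hn : 0 < n)
    {θ θv : ℝ} (hθ : 0 < θ) (hslack : C.a + (θ + θv) ≤ O.γ₀ * O.A₁ ^ 2 / 2)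
    (hE₂ : 0 < C.E₂) (hE₃ : 0 ≤ C.E₃) {sS : ℕ} (hsS : 1 ≤ sS)
    (hsmall : (((2 * cth 32 1 sS + 1) ^ d : ℕ) : ℝ) * (5 : ℝ) ^ d * ((max 1 (2 * 32 + 2) : ℕ) : ℝ) ≤
      (F.L : ℝ) ^ (sS / 2) / 2)
    {θc : ℝ} (hθc0 : 0 ≤ θc) (hθc1 : θc < 1) (hθcs : 1 / 2 ≤ θc ^ sS)
    {cΛ M Lr Φ b₀ : ℝ} {p₁ η η' κ κ₂ κᵥ : ℕ}
    (hRead : T4ContinuumYM4Torus.ForSmallCouplings D fun g₀ => ∀ os : List (ULoop F),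
        ∃ (P : Type) (_ : DecidableEq P) (X : ℕ → ℕ → Type) (𝒢 : (K j : ℕ) → GoodClass (X K j))
          (_ : ∀ K, MeasurableSpace (X K K)) (μ : (K : ℕ) → Measure (X K K)) (_ : ∀ K, IsFiniteMeasure (μ K))
          (DomK' : ℕ → Type) (I' : (K : ℕ) → HIndex (DomK' K))
          (Y : ℕ → Type) (_ : ∀ K, MeasurableSpace (Y K)) (νB : (K : ℕ) → Measure (Y K))
          (_ : ∀ K, IsFiniteMeasure (νB K)) (𝒢' : (K : ℕ) → GoodClass (Y K)),
          Nonempty (TowerReadDataLWL D C O θv rr d n hn g₀ os cΛ M Lr Φ b₀ p₁ η η' κ κ₂ κᵥ P X 𝒢 μ I' Y νB 𝒢')) :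
    T4ContinuumYM4Torus.ContinuumYM4Torus D :=
  continuumYM4Torus_of_histReadingLWL_fsc D hBA hE hB hβ hsign h hμ d n hκ₁ hE₀ hA₀ hβ₀ hLβ hn₁ hn hθ hslack hE₂ hE₃ hsS
    hsmall hθc0 hθc1 hθcs
    (hRead.mono fun g₀ hg os => by
      obtain ⟨P, iP, X, 𝒢, mX, μ, hμf, DomK', I', Y, mY, νB, hνf, 𝒢', ⟨Dd⟩⟩ := hg os
      exact ⟨fun _ => Unit, skelFam Dd.T Dd.p₀, inferInstance, DomK', I', fun K => X K K, inferInstance, μ, hμf,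
        fun K => 𝒢 K K, Y, mY, νB, hνf, 𝒢', ⟨Dd.toLWL⟩⟩)

end SU

end

end Summit.QuantumFields.BalabanUV.T4Continuum.B16HistoryTowerEndLWLP82
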